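import Summits.QuantumAdvantage.QuantumAdvantage.Theorems.LinnikCubicClassGroupsDegreeOnePrimesEscapeLeastPrimeIdeal
import Literature.NumberTheory.GaloisRepresentations.SplitsCompletelyCriteria
import Literature.NumberTheory.LFunctions.GRHPrimeIdealCountLowerBound
import Mathlib.NumberTheory.NumberField.Discriminant.Different
import HarnessLib

/-!
# The least UNRAMIFIED degree-one prime in an ideal class, and the least completely split prime

Topic `Summits/QuantumAdvantage/QuantumAdvantage/Theorems`, cell B2b-1 (linnik-cubic), PART B (gen 6);
helper toward the crux `DegreeOnePrimesEscape` (stmt-QuantumAdvantage-11543) of route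
`LinnikCubicClassGroups`.  HONEST FRAMING: the value of this file is a THEOREM (kernel-checked, GRH-free,
no hypothesis) — NOT summit progress.

PART A's unconditional class prime number theorem (`thetaClass_relative`, Thorner–Zaman Thm 1.4 for the
Hilbert class field with the Deuring–Heilbronn phenomenon, `…LeastPrimeIdeal.lean`) gave Linnik's theorem
for DEGREE-ONE prime ideals in ideal classes (`exists_degOnePrime_mem_class_absNorm_le`).  Here the primes
are in addition taken UNRAMIFIED over `ℚ` (`N𝔭 = p ∤ d_K`): the ramified degree-one primes have norm
`p ∣ d_K ≤ Q`, so there are at most `π_K(|d_K|) ≤ 2[K:ℚ]|d_K| ≤ 2Q²` of them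
(`primeIdealCount_le_two_mul_finrank_mul`), far fewer than the `≫ x Q^{−6}/log x` degree-one primes of the
class below `x = Q^L`.  Consequences:

* `exists_unramifiedDegOnePrime_mem_class_absNorm_le` — for `n > 1` there is `L = L(n)` such that every
  ideal class of every number field `K` of degree `n` contains a prime `𝔭` with `N𝔭 = p` prime,
  `p ∤ d_K`, `N𝔭 ≤ Q^L` (`Q = |d_K| nⁿ`);
* `exists_splitsCompletely_le` — **the least completely split prime**: for `n > 1` there is `L(n)`
  such that for every GALOIS number field `K/ℚ` of degree `n` some prime `p ≤ Q^L` splits completely in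
  `K` (below an unramified degree-one prime the rational prime splits completely in a Galois field,
  `Literature.NumberTheory.GaloisRepresentations.splitsCompletely_absNorm_of_prime_absNorm`), and
  `exists_splitsCompletely_le_discr` — the same with `p ≤ |d_K|^{L}`.  (Lagarias–Montgomery–Odlyzko 1979
  give `p ≤ |d_K|^{c}` with an ABSOLUTE `c`; here `L` depends on the degree, but the proof is the
  kernel-checked class-field-free one of this cell.)

References: J. C. Lagarias, H. L. Montgomery, A. M. Odlyzko, *A bound for the least prime ideal in the
Chebotarev density theorem*, Invent. Math. 54 (1979) 271–296 [LagariasMontgomeryOdlyzko1979];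
A. Weiss, J. reine angew. Math. 338 (1983), Thm. 5.2 [Weiss1983]; J. Thorner, A. Zaman, Algebra Number
Theory 13 (2019), Thm. 1.4 [ThornerZaman2019].
-/

noncomputable section

open Complex Real MeasureTheory Set Filter Topology
open scoped NumberField nonZeroDivisors

namespace Summit.QuantumAdvantage.QuantumAdvantage.Theorems.DegreeOnePrimesEscape

open Literature.NumberTheory.LFunctions Literature.NumberTheory.LFunctions.NumberField
  Literature.NumberTheory.LFunctions.AbelianDensity

/-! ### Ramified degree-one primes are few -/

/-- A prime ideal of prime norm `p` dividing the discriminant has norm `≤ |d_K|`; hence the degree-one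
primes of a class whose norm divides `d_K` are among the prime ideals of norm `≤ |d_K|`. [folklore] -/
theorem ramifiedDegOne_subset_primeIdealsLE (K : Type) [Field K] [NumberField K] (C : ClassGroup (𝓞 K))
    (x : ℝ) :
    {P : Ideal (𝓞 K) | (Ideal.absNorm P).Prime ∧ (Ideal.absNorm P : ℝ) ≤ x ∧
        (∃ hP : P ∈ (Ideal (𝓞 K))⁰, ClassGroup.mk0 ⟨P, hP⟩ = C) ∧
        ((Ideal.absNorm P : ℤ) ∣ NumberField.discr K)} ⊆
      primeIdealsLE K ((NumberField.discr K).natAbs : ℝ) := by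
  rintro P ⟨hprime, -, -, hdvd⟩
  refine ⟨Ideal.isPrime_of_irreducible_absNorm hprime, ?_, ?_⟩
  · intro h; rw [h, Ideal.absNorm_bot] at hprime; exact Nat.not_prime_zero hprime
  · have hd0 : (NumberField.discr K).natAbs ≠ 0 := Int.natAbs_ne_zero.mpr (NumberField.discr_ne_zero K)
    have h1 : Ideal.absNorm P ∣ (NumberField.discr K).natAbs := Int.natCast_dvd.mp hdvd
    exact_mod_cast Nat.le_of_dvd (Nat.pos_of_ne_zero hd0) h1

/-- **The ramified degree-one primes of a class number at most `2[K:ℚ]·|d_K|`.** [folklore] -/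
theorem ncard_ramifiedDegOne_le (K : Type) [Field K] [NumberField K] (C : ClassGroup (𝓞 K)) (x : ℝ) :
    (Set.ncard {P : Ideal (𝓞 K) | (Ideal.absNorm P).Prime ∧ (Ideal.absNorm P : ℝ) ≤ x ∧
        (∃ hP : P ∈ (Ideal (𝓞 K))⁰, ClassGroup.mk0 ⟨P, hP⟩ = C) ∧
        ((Ideal.absNorm P : ℤ) ∣ NumberField.discr K)} : ℝ) ≤
      2 * Module.finrank ℚ K * ((NumberField.discr K).natAbs : ℝ) := by
  have hsub := ramifiedDegOne_subset_primeIdealsLE K C x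
  have h1 : (Set.ncard {P : Ideal (𝓞 K) | (Ideal.absNorm P).Prime ∧ (Ideal.absNorm P : ℝ) ≤ x ∧
        (∃ hP : P ∈ (Ideal (𝓞 K))⁰, ClassGroup.mk0 ⟨P, hP⟩ = C) ∧
        ((Ideal.absNorm P : ℤ) ∣ NumberField.discr K)} : ℝ) ≤
      primeIdealCount K ((NumberField.discr K).natAbs : ℝ) := by
    exact_mod_cast Set.ncard_le_ncard hsub (finite_primeIdealsLE K _)
  exact h1.trans (primeIdealCount_le_two_mul_finrank_mul K (Nat.cast_nonneg _))

/-- Splitting the degree-one primes of a class below `x` into unramified and ramified ones: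
`#deg-1 ≤ #(deg-1, p ∤ d_K) + #(deg-1, p ∣ d_K)`. [folklore] -/
theorem degOneClassCount_le_unramified_add (K : Type) [Field K] [NumberField K]
    (C : ClassGroup (𝓞 K)) (x : ℝ) :
    (degOneClassCount K C x : ℝ) ≤
      Set.ncard {P : Ideal (𝓞 K) | (Ideal.absNorm P).Prime ∧ (Ideal.absNorm P : ℝ) ≤ x ∧
        (∃ hP : P ∈ (Ideal (𝓞 K))⁰, ClassGroup.mk0 ⟨P, hP⟩ = C) ∧
        ¬ ((Ideal.absNorm P : ℤ) ∣ NumberField.discr K)} +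
      Set.ncard {P : Ideal (𝓞 K) | (Ideal.absNorm P).Prime ∧ (Ideal.absNorm P : ℝ) ≤ x ∧
        (∃ hP : P ∈ (Ideal (𝓞 K))⁰, ClassGroup.mk0 ⟨P, hP⟩ = C) ∧
        ((Ideal.absNorm P : ℤ) ∣ NumberField.discr K)} := by
  rw [degOneClassCount]
  have hunion : {P : Ideal (𝓞 K) | (Ideal.absNorm P).Prime ∧ (Ideal.absNorm P : ℝ) ≤ x ∧
        ∃ hP : P ∈ (Ideal (𝓞 K))⁰, ClassGroup.mk0 ⟨P, hP⟩ = C} ⊆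
      {P : Ideal (𝓞 K) | (Ideal.absNorm P).Prime ∧ (Ideal.absNorm P : ℝ) ≤ x ∧
        (∃ hP : P ∈ (Ideal (𝓞 K))⁰, ClassGroup.mk0 ⟨P, hP⟩ = C) ∧
        ¬ ((Ideal.absNorm P : ℤ) ∣ NumberField.discr K)} ∪
      {P : Ideal (𝓞 K) | (Ideal.absNorm P).Prime ∧ (Ideal.absNorm P : ℝ) ≤ x ∧
        (∃ hP : P ∈ (Ideal (𝓞 K))⁰, ClassGroup.mk0 ⟨P, hP⟩ = C) ∧
        ((Ideal.absNorm P : ℤ) ∣ NumberField.discr K)} := by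
    rintro P ⟨h1, h2, h3⟩
    by_cases h : ((Ideal.absNorm P : ℤ) ∣ NumberField.discr K)
    · exact Or.inr ⟨h1, h2, h3, h⟩
    · exact Or.inl ⟨h1, h2, h3, h⟩
  have hfin : ({P : Ideal (𝓞 K) | (Ideal.absNorm P).Prime ∧ (Ideal.absNorm P : ℝ) ≤ x ∧
        (∃ hP : P ∈ (Ideal (𝓞 K))⁰, ClassGroup.mk0 ⟨P, hP⟩ = C) ∧
        ¬ ((Ideal.absNorm P : ℤ) ∣ NumberField.discr K)} ∪
      {P : Ideal (𝓞 K) | (Ideal.absNorm P).Prime ∧ (Ideal.absNorm P : ℝ) ≤ x ∧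
        (∃ hP : P ∈ (Ideal (𝓞 K))⁰, ClassGroup.mk0 ⟨P, hP⟩ = C) ∧
        ((Ideal.absNorm P : ℤ) ∣ NumberField.discr K)}).Finite := by
    refine ((Ideal.finite_setOf_absNorm_le (S := 𝓞 K) ⌊x⌋₊).subset ?_)
    rintro P (⟨h1, h2, -⟩ | ⟨h1, h2, -⟩) <;>
      exact Nat.le_floor h2
  have h := Set.ncard_le_ncard hunion hfin
  have h2 := Set.ncard_union_le
    {P : Ideal (𝓞 K) | (Ideal.absNorm P).Prime ∧ (Ideal.absNorm P : ℝ) ≤ x ∧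
        (∃ hP : P ∈ (Ideal (𝓞 K))⁰, ClassGroup.mk0 ⟨P, hP⟩ = C) ∧
        ¬ ((Ideal.absNorm P : ℤ) ∣ NumberField.discr K)}
    {P : Ideal (𝓞 K) | (Ideal.absNorm P).Prime ∧ (Ideal.absNorm P : ℝ) ≤ x ∧
        (∃ hP : P ∈ (Ideal (𝓞 K))⁰, ClassGroup.mk0 ⟨P, hP⟩ = C) ∧
        ((Ideal.absNorm P : ℤ) ∣ NumberField.discr K)}
  exact_mod_cast h.trans h2

/-! ### Linnik's theorem for unramified degree-one primes in ideal classes -/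

set_option maxHeartbeats 800000 in
/-- **Linnik's theorem for UNRAMIFIED degree-one prime ideals in ideal classes, every degree,
unconditionally**: for `n > 1` there is `L > 0` such that every ideal class of every number field `K` of
degree `n` contains a prime ideal `𝔭` whose norm is a rational prime `p ≤ Q^{L}` NOT dividing `d_K`
(`Q = |d_K|·nⁿ`).  The argument of `exists_degOnePrime_mem_class_absNorm_le` (θ_C(x) ≥ x c₁Q⁻²/(8h) at
`x = Q^L` from `thetaClass_relative` and Stark's effective bound, `π_C ≥ θ_C/log x`, at most `n(√x+1)`
primes of degree `≥ 2`) with the `≤ 2n|d_K| ≤ 2Q²` ramified degree-one primes removed as well.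
[cite: Weiss1983, Theorem 5.2] [cite: ThornerZaman2019, Theorem 1.4] -/
theorem exists_unramifiedDegOnePrime_mem_class_absNorm_le (n : ℕ) (hn : 1 < n) :
    ∃ L : ℝ, 0 < L ∧ ∀ (K : Type) [Field K] [NumberField K], Module.finrank ℚ K = n →
      ∀ C : ClassGroup (𝓞 K), ∃ (P : Ideal (𝓞 K)) (hP : P ∈ (Ideal (𝓞 K))⁰), (Ideal.absNorm P).Prime ∧
        ¬ ((Ideal.absNorm P : ℤ) ∣ NumberField.discr K) ∧
        ClassGroup.mk0 ⟨P, hP⟩ = C ∧ (Ideal.absNorm P : ℝ) ≤ ThornerZaman.condQn K ^ L := by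
  classical
  obtain ⟨a₂, c, ha₂1, hc, hcn, hθ⟩ := thetaClass_relative n hn (by norm_num : (0 : ℝ) < 1 / 2)
  obtain ⟨c₁, hc₁, hc₁1, heff⟩ := Residue.one_sub_realZero_ge_condQn_rpow n hn
  have hn2 : (2 : ℝ) ≤ n := by exact_mod_cast hn
  set L : ℝ := max (max a₂ 32) (80 + 256 / c₁) with hL
  have hLa₂ : a₂ ≤ L := le_trans (le_max_left _ _) (le_max_left _ _)
  have hL32 : (32 : ℝ) ≤ L := le_trans (le_max_right _ _) (le_max_left _ _)
  have hLu : 80 + 256 / c₁ ≤ L := le_max_right _ _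
  refine ⟨L, by linarith, fun K _ _ hKn C ↦ ?_⟩
  have hK : 1 < Module.finrank ℚ K := by rw [hKn]; exact hn
  set Q : ℝ := ThornerZaman.condQn K with hQ
  have hQ12 : (12 : ℝ) ≤ Q := ThornerZaman.twelve_le_condQn (K := K) hK
  have hQ1 : (1 : ℝ) < Q := by linarith
  have hQ0 : (0 : ℝ) < Q := by linarith
  have hQne : Q ≠ 0 := hQ0.ne'
  have hlogQ : 2 ≤ Real.log Q := two_lt_log_twelve.le.trans (Real.log_le_log (by norm_num) hQ12)
  have hlogQQ : Real.log Q ≤ Q := by have := Real.log_le_sub_one_of_pos hQ0; linarith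
  set x : ℝ := Q ^ L with hx
  have hxa₂ : Q ^ a₂ ≤ x := Real.rpow_le_rpow_of_exponent_le hQ1.le hLa₂
  have hxQ : Q ≤ x := by
    have := Real.rpow_le_rpow_of_exponent_le hQ1.le (show (1 : ℝ) ≤ L by linarith)
    rwa [Real.rpow_one] at this
  have hx1 : (1 : ℝ) < x := by linarith
  have hx0 : 0 < x := by linarith
  have hlogx : Real.log x = L * Real.log Q := by rw [hx, Real.log_rpow hQ0]
  have hlogx0 : 0 < Real.log x := Real.log_pos hx1
  have hLlog : 32 * 2 ≤ L * Real.log Q := mul_le_mul hL32 hlogQ (by norm_num) (by linarith)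
  have hlogx1 : 1 ≤ Real.log x := by rw [hlogx]; linarith
  have hL16 : 16 ≤ Real.log x := by rw [hlogx]; linarith
  have hL80 : 80 < L := by have := div_pos (by norm_num : (0 : ℝ) < 256) hc₁; linarith
  set h : ℝ := (NumberField.classNumber K : ℝ) with hh
  have hh1 : 1 ≤ h := by rw [hh]; exact_mod_cast one_le_classNumber (K := K)
  have hh0 : 0 < h := by linarith
  have hhQ : h ≤ Q ^ 4 := by
    have := ThornerZaman.classNumber_le_condQn_pow (K := K) hK; rw [← hQ] at this; exact this
  have hnQ : (Module.finrank ℚ K : ℝ) ≤ Q := ThornerZaman.finrank_le_condQn (K := K)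
  -- `|d_K| ≤ Q`
  have hdQ : ((NumberField.discr K).natAbs : ℝ) ≤ Q := by
    have hQdef : Q = ((NumberField.discr K).natAbs : ℝ) * (Module.finrank ℚ K : ℝ) ^ Module.finrank ℚ K := by
      rw [hQ, ThornerZaman.condQn, Nat.cast_natAbs, Int.cast_abs]
    rw [hQdef]
    have h1 : (1 : ℝ) ≤ (Module.finrank ℚ K : ℝ) ^ Module.finrank ℚ K :=
      one_le_pow₀ (by exact_mod_cast hK.le)
    exact le_mul_of_one_le_right (Nat.cast_nonneg _) h1
  have hQm2' : 0 < Q ^ (-(2 : ℝ)) := Real.rpow_pos_of_pos hQ0 _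
  have hQm2 : Q ^ (-(2 : ℝ)) ≤ 1 := Real.rpow_le_one_of_one_le_of_nonpos hQ1.le (by norm_num)
  set m' : ℝ := c₁ * Q ^ (-(2 : ℝ)) with hm'
  have hm'0 : 0 < m' := mul_pos hc₁ hQm2'
  have hm'1 : m' ≤ 1 := (mul_le_mul hc₁1 hQm2 hQm2'.le zero_le_one).trans (by norm_num)
  have hm'2 : m' = c₁ * (Q ^ 2)⁻¹ := by rw [hm', Real.rpow_neg hQ0.le, Real.rpow_two]
  -- Step 1: `θ_C(x) ≥ x m' / (8 h)`
  have hθlow : x * m' / (8 * h) ≤ chebyshevThetaIdealClass K C x := by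
    have hcmp : x * m' / (8 * h) ≤ x / h - 1 / 2 * x / h := by
      rw [show x / h - 1 / 2 * x / h = x * 4 / (8 * h) by field_simp; ring]
      exact div_le_div_of_nonneg_right (mul_le_mul_of_nonneg_left (by linarith) hx0.le) (by positivity)
    rcases hθ K hKn with hgood | ⟨χ₁, β₁, hreal, hβlow, hβ1, hLz, hexc⟩
    · have h1 := (abs_sub_le_iff.1 (hgood x hxa₂ C)).2
      linarith
    · obtain ⟨hM0, hb⟩ := hexc x hxa₂ C
      have h1 := (abs_sub_le_iff.1 hb).2
      have hδ : m' ≤ 1 - β₁ := heff K hKn χ₁ hreal β₁ hβ1 hLz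
      have hβ34 : 3 / 4 ≤ β₁ := by
        have hlog4 : 1 < Real.log 4 := by
          rw [show (4:ℝ) = 2 ^ 2 by norm_num, Real.log_pow]; have := Real.log_two_gt_d9; push_cast; linarith
        have hlogd : 0 ≤ Real.log ((NumberField.discr K).natAbs : ℝ) := Real.log_natCast_nonneg _
        have hc4 : c ≤ 1 / 4 := by
          refine hcn.trans ?_
          rw [div_le_div_iff_of_pos_left one_pos (by positivity) (by norm_num)]
          have := sq_nonneg (n : ℝ); linarith
        have : c / (Real.log ((NumberField.discr K).natAbs : ℝ) + Real.log 4) ≤ 1 / 4 := by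
          rw [div_le_iff₀ (by linarith)]; linarith
        linarith
      have hM := sub_mul_rpow_div_ge hx1 hL16 hβ34 hβ1 (abs_re_classGroupChar_apply_le hreal C)
      have hmin : m' ≤ min 1 ((1 - β₁) * Real.log x) := by
        refine le_min hm'1 (hδ.trans ?_)
        have := mul_le_mul_of_nonneg_left hlogx1 (by linarith : (0 : ℝ) ≤ 1 - β₁); linarith
      set M : ℝ := x - ((χ₁ C : ℂ)).re * x ^ β₁ / β₁ with hMdef
      have hM' : x / 4 * m' ≤ M := le_trans (mul_le_mul_of_nonneg_left hmin (by positivity)) hM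
      have h2 : x * m' / (8 * h) ≤ M / h - 1 / 2 * M / h := by
        rw [show M / h - 1 / 2 * M / h = M * 4 / (8 * h) by field_simp; ring]
        exact div_le_div_of_nonneg_right (by linarith) (by positivity)
      linarith
  -- Step 2: `π_C(x) ≥ θ_C(x)/log x`, the degree-`≥ 2` count, and the ramified count
  have hπ : x * m' / (8 * h) / Real.log x ≤ primeIdealClassCount K C x := by
    have := chebyshevThetaIdealClass_le_count_mul_log C hx1.le
    rw [div_le_iff₀ hlogx0]; linarith
  have hdeg := primeIdealClassCount_sub_degOneClassCount_le K C hx0.le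
  have hsplit := degOneClassCount_le_unramified_add K C x
  have hram := ncard_ramifiedDegOne_le K C x
  -- Step 3: `32 L Q⁸ < c₁ √x`
  have hsx0 : 0 < Real.sqrt x := Real.sqrt_pos.2 hx0
  have hxx : Real.sqrt x * Real.sqrt x = x := Real.mul_self_sqrt hx0.le
  have hC : 32 * L * Q ^ 8 < c₁ * Real.sqrt x := by
    have hsx : Real.sqrt x = Q ^ (8 : ℝ) * Q ^ (L / 2 - 8) := by
      rw [Real.sqrt_eq_rpow, hx, ← Real.rpow_mul hQ0.le, ← Real.rpow_add hQ0]; ring_nf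
    have hQ8 : Q ^ (8 : ℝ) = Q ^ 8 := by norm_cast
    have hexp : Real.exp (L - 16) ≤ Q ^ (L / 2 - 8) := by
      rw [Real.rpow_def_of_pos hQ0, Real.exp_le_exp]
      have : 2 * (L / 2 - 8) ≤ Real.log Q * (L / 2 - 8) :=
        mul_le_mul_of_nonneg_right hlogQ (by linarith)
      linarith
    have hu : (L - 16) ^ 2 / 4 ≤ Real.exp (L - 16) := by
      have h1 := Real.add_one_le_exp ((L - 16) / 2)
      have h2 : Real.exp (L - 16) = Real.exp ((L - 16) / 2) * Real.exp ((L - 16) / 2) := by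
        rw [← Real.exp_add]; ring_nf
      rw [h2]
      have h3 : 0 ≤ (L - 16) / 2 + 1 := by linarith
      have h4 := mul_le_mul h1 h1 h3 (Real.exp_pos _).le
      have e : ((L - 16) / 2 + 1) * ((L - 16) / 2 + 1) = (L - 16) ^ 2 / 4 + (L - 16) + 1 := by ring
      linarith
    have hpoly : 32 * L < c₁ * ((L - 16) ^ 2 / 4) := by
      have hu0 : 64 + 256 / c₁ ≤ L - 16 := by linarith
      have h1 : 16 * c₁ + 64 ≤ c₁ * (L - 16) / 4 := by
        have := mul_le_mul_of_nonneg_left hu0 hc₁.le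
        have e : c₁ * (64 + 256 / c₁) = 64 * c₁ + 256 := by field_simp
        linarith
      have h2 : (16 * c₁ + 64) * (L - 16) ≤ c₁ * (L - 16) / 4 * (L - 16) :=
        mul_le_mul_of_nonneg_right h1 (by linarith)
      have h3 : 0 ≤ c₁ * (L - 16) := mul_nonneg hc₁.le (by linarith)
      have e1 : c₁ * (L - 16) / 4 * (L - 16) = c₁ * ((L - 16) ^ 2 / 4) := by ring
      have e2 : (16 * c₁ + 64) * (L - 16) = 16 * (c₁ * (L - 16)) + 64 * L - 1024 := by ring
      linarith
    calc 32 * L * Q ^ 8 < c₁ * ((L - 16) ^ 2 / 4) * Q ^ 8 := mul_lt_mul_of_pos_right hpoly (pow_pos hQ0 8)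
      _ ≤ c₁ * Q ^ (L / 2 - 8) * Q ^ 8 :=
          mul_le_mul_of_nonneg_right (mul_le_mul_of_nonneg_left (hu.trans hexp) hc₁.le) (by positivity)
      _ = c₁ * Real.sqrt x := by rw [hsx, hQ8]; ring
  -- Step 4: `n (√x + 1) + 2 n |d_K| < x m'/(8 h log x)`
  have hkey : (Module.finrank ℚ K : ℝ) * (Real.sqrt x + 1) +
      2 * Module.finrank ℚ K * ((NumberField.discr K).natAbs : ℝ) < x * m' / (8 * h) / Real.log x := by
    have hsqrt1 : 1 ≤ Real.sqrt x := by rw [← Real.sqrt_one]; exact Real.sqrt_le_sqrt hx1.le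
    have hQsx : Q ≤ Real.sqrt x := by
      -- `√x = Q^{L/2} ≥ Q`
      have : Q ^ (1 : ℝ) ≤ Q ^ (L / 2) := Real.rpow_le_rpow_of_exponent_le hQ1.le (by linarith)
      rw [Real.rpow_one] at this
      rw [Real.sqrt_eq_rpow, hx, ← Real.rpow_mul hQ0.le]
      convert this using 2; ring
    have hn0 : (0 : ℝ) ≤ (Module.finrank ℚ K : ℝ) := Nat.cast_nonneg _
    have hA : (Module.finrank ℚ K : ℝ) * (Real.sqrt x + 1) +
        2 * Module.finrank ℚ K * ((NumberField.discr K).natAbs : ℝ) ≤ 4 * Q * Real.sqrt x :=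
      calc (Module.finrank ℚ K : ℝ) * (Real.sqrt x + 1) +
            2 * Module.finrank ℚ K * ((NumberField.discr K).natAbs : ℝ)
          ≤ Q * (Real.sqrt x + 1) + 2 * Q * Q := by
            have h1 := mul_le_mul_of_nonneg_right hnQ (show 0 ≤ Real.sqrt x + 1 by positivity)
            have h2 : 2 * (Module.finrank ℚ K : ℝ) * ((NumberField.discr K).natAbs : ℝ) ≤ 2 * Q * Q :=
              mul_le_mul (by linarith) hdQ (Nat.cast_nonneg _) (by positivity)
            linarith
        _ ≤ Q * (2 * Real.sqrt x) + 2 * Q * Real.sqrt x := by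
            have h1 : Q * (Real.sqrt x + 1) ≤ Q * (2 * Real.sqrt x) :=
              mul_le_mul_of_nonneg_left (by linarith) hQ0.le
            have h2 : 2 * Q * Q ≤ 2 * Q * Real.sqrt x := mul_le_mul_of_nonneg_left hQsx (by positivity)
            linarith
        _ = 4 * Q * Real.sqrt x := by ring
    have hden : 0 < 8 * h * Real.log x := by positivity
    have hden' : 8 * h * Real.log x ≤ 8 * L * Q ^ 5 := by
      rw [hlogx]
      have h1 : h * (L * Real.log Q) ≤ Q ^ 4 * (L * Real.log Q) :=
        mul_le_mul_of_nonneg_right hhQ (by positivity)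
      have h2 : Q ^ 4 * (L * Real.log Q) ≤ Q ^ 4 * (L * Q) :=
        mul_le_mul_of_nonneg_left (mul_le_mul_of_nonneg_left hlogQQ (by linarith)) (by positivity)
      have e1 : 8 * h * (L * Real.log Q) = 8 * (h * (L * Real.log Q)) := by ring
      have e2 : 8 * L * Q ^ 5 = 8 * (Q ^ 4 * (L * Q)) := by ring
      rw [e1, e2]; linarith
    have h1 : x * m' / (8 * L * Q ^ 5) ≤ x * m' / (8 * h) / Real.log x := by
      rw [div_div]; exact div_le_div_of_nonneg_left (by positivity) hden hden'
    have h2 : 4 * Q * Real.sqrt x < x * m' / (8 * L * Q ^ 5) := by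
      rw [lt_div_iff₀ (by positivity), hm'2]
      have e1 : 4 * Q * Real.sqrt x * (8 * L * Q ^ 5) = (32 * L * Q ^ 8) * Real.sqrt x * (Q ^ 2)⁻¹ := by
        field_simp; ring
      have hQ2pos : 0 < (Q ^ 2)⁻¹ := by positivity
      have h3 : (32 * L * Q ^ 8) * Real.sqrt x * (Q ^ 2)⁻¹ < (c₁ * Real.sqrt x) * Real.sqrt x * (Q ^ 2)⁻¹ :=
        mul_lt_mul_of_pos_right (mul_lt_mul_of_pos_right hC hsx0) hQ2pos
      have e3 : (c₁ * Real.sqrt x) * Real.sqrt x * (Q ^ 2)⁻¹ = x * (c₁ * (Q ^ 2)⁻¹) := by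
        rw [mul_assoc c₁, hxx]; ring
      linarith [e1, h3, e3]
    linarith
  -- hence an unramified degree-one prime exists in `C` below `x`
  have hpos : 0 < (Set.ncard {P : Ideal (𝓞 K) | (Ideal.absNorm P).Prime ∧ (Ideal.absNorm P : ℝ) ≤ x ∧
        (∃ hP : P ∈ (Ideal (𝓞 K))⁰, ClassGroup.mk0 ⟨P, hP⟩ = C) ∧
        ¬ ((Ideal.absNorm P : ℤ) ∣ NumberField.discr K)} : ℝ) := by linarith
  have hne : Set.ncard {P : Ideal (𝓞 K) | (Ideal.absNorm P).Prime ∧ (Ideal.absNorm P : ℝ) ≤ x ∧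
        (∃ hP : P ∈ (Ideal (𝓞 K))⁰, ClassGroup.mk0 ⟨P, hP⟩ = C) ∧
        ¬ ((Ideal.absNorm P : ℤ) ∣ NumberField.discr K)} ≠ 0 := by
    intro h0; rw [h0, Nat.cast_zero] at hpos; exact lt_irrefl _ hpos
  obtain ⟨P, hPprime, hPx, ⟨hP0, hPC⟩, hndvd⟩ := Set.nonempty_of_ncard_ne_zero hne
  exact ⟨P, hP0, hPprime, hndvd, hPC, hPx⟩

/-! ### The least completely split prime in a Galois number field -/

/-- Below a degree-one prime `𝔭` of `K` with `N𝔭 = p ∤ d_K`, `p` is unramified at `𝔭`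
(Mathlib `NumberField.not_dvd_discr_iff_forall_mem`). [folklore] -/
theorem isUnramifiedAt_of_prime_absNorm_not_dvd_discr {K : Type} [Field K] [NumberField K]
    {P : Ideal (𝓞 K)} [P.IsPrime] (hprime : (Ideal.absNorm P).Prime)
    (hndvd : ¬ ((Ideal.absNorm P : ℤ) ∣ NumberField.discr K)) : Algebra.IsUnramifiedAt ℤ P := by
  have hp : Prime ((Ideal.absNorm P : ℕ) : ℤ) := Nat.prime_iff_prime_int.mp hprime
  refine (NumberField.not_dvd_discr_iff_forall_mem K (𝓞 K) hp).mp hndvd P inferInstance ?_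
  rw [Int.cast_natCast]
  exact Ideal.absNorm_mem P

/-- **The least completely split prime in a Galois number field, unconditionally**: for `n > 1` there
is `L > 0` such that for every number field `K` of degree `n`, Galois over `ℚ`, some rational prime
`p ≤ Q^{L}` (`Q = |d_K| nⁿ`) splits completely in `K` — indeed one below a principal... (any prescribed
ideal class `C` contains a degree-one prime above such a `p`).  Below an unramified degree-one prime the
rational prime splits completely in a Galois field
(`Literature.NumberTheory.GaloisRepresentations.splitsCompletely_absNorm_of_prime_absNorm`).
[cite: LagariasMontgomeryOdlyzko1979, Theorem 1.1 (there with an absolute exponent)]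
[cite: Weiss1983, Theorem 5.2] -/
theorem exists_splitsCompletely_le (n : ℕ) (hn : 1 < n) :
    ∃ L : ℝ, 0 < L ∧ ∀ (K : Type) [Field K] [NumberField K] [IsGalois ℚ K], Module.finrank ℚ K = n →
      ∀ C : ClassGroup (𝓞 K), ∃ (P : Ideal (𝓞 K)) (hP : P ∈ (Ideal (𝓞 K))⁰),
        (Ideal.absNorm P).Prime ∧ ClassGroup.mk0 ⟨P, hP⟩ = C ∧
        Literature.NumberTheory.GaloisRepresentations.SplitsCompletely K (Ideal.absNorm P) ∧
        (Ideal.absNorm P : ℝ) ≤ ThornerZaman.condQn K ^ L := by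
  obtain ⟨L, hL, h⟩ := exists_unramifiedDegOnePrime_mem_class_absNorm_le n hn
  refine ⟨L, hL, fun K _ _ _ hKn C ↦ ?_⟩
  obtain ⟨P, hP0, hprime, hndvd, hC, hle⟩ := h K hKn C
  refine ⟨P, hP0, hprime, hC, ?_, hle⟩
  haveI := Ideal.isPrime_of_irreducible_absNorm hprime
  have hPbot : P ≠ ⊥ := nonZeroDivisors.ne_zero hP0
  set w : IsDedekindDomain.HeightOneSpectrum (𝓞 K) := ⟨P, inferInstance, hPbot⟩ with hw
  have := Literature.NumberTheory.GaloisRepresentations.splitsCompletely_absNorm_of_prime_absNorm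
    (M := K) (E := K) w hprime (isUnramifiedAt_of_prime_absNorm_not_dvd_discr hprime hndvd)
  exact this

/-- **The least completely split prime, discriminant form**: for `n > 1` there is `L > 0` such that for
every Galois number field `K/ℚ` of degree `n` some prime `p ≤ |d_K|^{L}` splits completely in `K`.
[cite: LagariasMontgomeryOdlyzko1979, Theorem 1.1 (there with an absolute exponent)] -/
theorem exists_splitsCompletely_le_discr (n : ℕ) (hn : 1 < n) :
    ∃ L : ℝ, 0 < L ∧ ∀ (K : Type) [Field K] [NumberField K] [IsGalois ℚ K], Module.finrank ℚ K = n →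
      ∃ p : ℕ, p.Prime ∧ Literature.NumberTheory.GaloisRepresentations.SplitsCompletely K p ∧
        (p : ℝ) ≤ ((NumberField.discr K).natAbs : ℝ) ^ L := by
  obtain ⟨L, hL, h⟩ := exists_splitsCompletely_le n hn
  have hn0 : (0 : ℝ) < n := by exact_mod_cast (lt_trans Nat.zero_lt_one hn)
  have hlog3 : 0 < Real.log 3 := Real.log_pos (by norm_num)
  have hlogn : 0 ≤ Real.log n := Real.log_nonneg (by exact_mod_cast hn.le)
  refine ⟨(1 + n * Real.log n / Real.log 3) * L, by positivity, fun K _ _ _ hKn ↦ ?_⟩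
  have hK : 1 < Module.finrank ℚ K := by rw [hKn]; exact hn
  obtain ⟨P, hP, hprime, -, hsplit, hle⟩ := h K hKn 1
  refine ⟨Ideal.absNorm P, hprime, hsplit, hle.trans ?_⟩
  have hd1 : (1 : ℝ) ≤ ((NumberField.discr K).natAbs : ℝ) := by
    have h1 := Int.one_le_abs (NumberField.discr_ne_zero K)
    rw [Int.abs_eq_natAbs] at h1
    exact_mod_cast h1
  have hQ := condQn_le_natAbs_discr_rpow K hK
  rw [hKn] at hQ
  calc ThornerZaman.condQn K ^ L ≤ (((NumberField.discr K).natAbs : ℝ) ^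
      (1 + n * Real.log n / Real.log 3)) ^ L :=
        Real.rpow_le_rpow (le_trans (by norm_num) (ThornerZaman.twelve_le_condQn (K := K) hK)) hQ hL.le
    _ = ((NumberField.discr K).natAbs : ℝ) ^ ((1 + n * Real.log n / Real.log 3) * L) := by
        rw [← Real.rpow_mul (by linarith)]

end Summit.QuantumAdvantage.QuantumAdvantage.Theorems.DegreeOnePrimesEscape

end
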